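import Summits.FinalStateConjecture.FinalStateConjecture.Theorems.EIHFluxBalanceInertialRecessionStubQuasiStationarityDecay
import Summits.FinalStateConjecture.FinalStateConjecture.Theorems.EIHFluxBalanceInertialRecessionStubQuasiStationarityStabiliser

/-!
# Route EIHFluxBalance — `InertialRecession`, line `sublinear-is-free-clean-window-charges`,
# stub `stub_quasiStationarity`: the lab-time derivative of one painted summand

Helper file (part 4 of the kinematic reduction of the stub `stub_quasiStationarity` of the crux
`stmt-FinalStateConjecture-10166`). For ONE summand of the crux's modulated background field,
`S(y) = boostedKerrBilin (Λ(y⁰)) (y⁰, ξ(y⁰)) M a y − η = (g_{M,a} − η)(Λ(y⁰)⁻¹(0, y̲ − ξ(y⁰)))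
(Λ(y⁰)⁻¹·, Λ(y⁰)⁻¹·)`, this file computes the TOTAL lab-time derivative `∂₀S(x) = DS(x)[e₀]` on the
slab `{x⁰ = t}` and proves the structural estimate announced in the stub's context:

  `‖∂₀S(x)‖ ≤ |M| G² ( (B₁G + 2B₀) ν / d + B₁ G ‖ξ̇(t)‖ / d² )`,  `d = ‖x̲ − ξ(t)‖ ≥ max 1 (2|a|)`,

`G = 1 + 3γ` (Euclidean size of `Λ⁻¹`), where `ν` is any bound for the body-frame rate
`ω = Λ(t)⁻¹Λ̇(t)` MODULO an element `ω_K` of the infinitesimal stabiliser of `g_{M,a}`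
(`‖(ω − ω_K)u‖ ≤ ν‖u‖`; by `…LorentzAlgebra`, `ν = 3G(‖u̇‖ + ‖(Λe₃)˙‖)` always works and
`ν = 4G‖u̇‖` works for `a = 0`). In words: for FROZEN moduli the summand is lab-static, so all of
`∂₀` falls on the rates; the `Λ̇`-channel has kernel `M/d` and only sees `Λ̇` modulo the stabiliser,
the `ξ̇`-channel has kernel `M/d²` (`norm_fderiv_summand_basisVector_zero_le`).

Steps: the summand along the time line through `x` is the scalar family
`s ↦ (g − η)(Λ(s)⁻¹q(s))(Λ(s)⁻¹v, Λ(s)⁻¹w)`, `q(s) = (0, x̲ − ξ(s))` (`summand_timeLine_apply`); its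
derivative is computed by the chain rule (`hasDerivAt_restFrame_scalar`) and identified with
`DS(x)[e₀](v, w)` (`fderiv_summand_basisVector_zero_apply`); the stabiliser part of `ω` drops out by
`stabiliser_generator_identity`, and the sharp decay `‖g − η‖ ≤ |M|B₀/d`, `‖D(g − η)‖ ≤ |M|B₁/d²`
(`…Decay`) gives the estimate.
-/

noncomputable section

namespace Summit.FinalStateConjecture.FinalStateConjecture.Theorems.SublinearIsFree.QuasiStationarity

open scoped BigOperators Topology ContDiff
open Filter Set Function Literature.Geometry.Lorentzian
open Summit.FinalStateConjecture.FinalStateConjecture.Theorems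
open Summit.FinalStateConjecture.FinalStateConjecture.Theorems.InertialRecession.Negative

/-! ### The summand along the lab-time line through a slab point -/

/-- On the time line `s ↦ x + (s − t)e₀` through a point `x` of the slab `{x⁰ = t}`, the lab time
is `s` and the position relative to the painted centre `(s, ξ(s))` is the SPATIAL vector
`(0, x̲ − ξ(s))` (bookkeeping). [folklore] -/
theorem timeLine_sub_centre {x : E4} {t : ℝ} (hx : x 0 = t) (ξ : ℝ → E3) (s : ℝ) :
    (x + (s - t) • E4.basisVector 0) 0 = s ∧
      x + (s - t) • E4.basisVector 0 - E4.ofTimeSpace s (ξ s) =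
        E4.spaceEmbed (E4.spatial x - ξ s) := by
  refine ⟨by simp [hx], ?_⟩
  ext k
  refine Fin.cases ?_ (fun i ↦ ?_) k
  · simp [hx]
  · simp [Fin.succ_ne_zero]

/-- **The painted summand along the time line is the rest-frame scalar family**: for `x⁰ = t`,
`S(x + (s − t)e₀)(v, w) = (g_{M,a} − η)(Λ(s)⁻¹(0, x̲ − ξ(s)))(Λ(s)⁻¹v, Λ(s)⁻¹w)` (Lorentz
invariance of `η`, `boostedKerrBilin_sub_minkowski_apply`). [cite: KerrSchild1965, §2] -/
theorem summand_timeLine_apply (M a : ℝ) (Λ : ℝ → lorentzGroup) (ξ : ℝ → E3) {x : E4} {t : ℝ}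
    (hx : x 0 = t) (s : ℝ) (v w : E4) :
    (boostedKerrBilin (Λ ((x + (s - t) • E4.basisVector 0) 0))
        (E4.ofTimeSpace ((x + (s - t) • E4.basisVector 0) 0)
          (ξ ((x + (s - t) • E4.basisVector 0) 0))) M a (x + (s - t) • E4.basisVector 0) -
        Minkowski.bilin) v w =
      (Kerr.bilin M a ((((Λ s : E4 ≃L[ℝ] E4).symm : E4 →L[ℝ] E4))
          (E4.spaceEmbed (E4.spatial x - ξ s))) - Minkowski.bilin)
        ((((Λ s : E4 ≃L[ℝ] E4).symm : E4 →L[ℝ] E4)) v)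
        ((((Λ s : E4 ≃L[ℝ] E4).symm : E4 →L[ℝ] E4)) w) := by
  obtain ⟨h0, hq⟩ := timeLine_sub_centre hx ξ s
  rw [h0, boostedKerrBilin_sub_minkowski_apply, poincareInv, hq]
  rfl

/-! ### The chain rule for the rest-frame scalar family -/

/-- **Derivative of the rest-frame scalar family.** For an operator path `A` with derivative `A'`
at `t`, a centre path `ξ` with derivative `ξ'` at `t`, and `g − η` differentiable at the rest-frame
point `p = A(t)(0, x̲ − ξ(t))`:
`d/ds|ₜ (g − η)(A(s)(0, x̲ − ξ(s)))(A(s)v, A(s)w) = D(g − η)(p)[A'(0, x̲ − ξ(t)) − A(t)(0, ξ')](A v, A w)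
 + (g − η)(p)(A'v, A w) + (g − η)(p)(A v, A'w)` (chain rule). [folklore] -/
theorem hasDerivAt_restFrame_scalar (M a : ℝ) {A : ℝ → E4 →L[ℝ] E4} {A' : E4 →L[ℝ] E4}
    {ξ : ℝ → E3} {ξ' : E3} {t : ℝ} (hA : HasDerivAt A A' t) (hξ : HasDerivAt ξ ξ' t) (z : E3)
    (hK : DifferentiableAt ℝ (fun y ↦ Kerr.bilin M a y - Minkowski.bilin)
      (A t (E4.spaceEmbed (z - ξ t)))) (v w : E4) :
    HasDerivAt (fun s ↦ (Kerr.bilin M a (A s (E4.spaceEmbed (z - ξ s))) - Minkowski.bilin)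
        (A s v) (A s w))
      (fderiv ℝ (fun y ↦ Kerr.bilin M a y - Minkowski.bilin) (A t (E4.spaceEmbed (z - ξ t)))
          (A' (E4.spaceEmbed (z - ξ t)) + A t (E4.spaceEmbed (-ξ'))) (A t v) (A t w) +
        (Kerr.bilin M a (A t (E4.spaceEmbed (z - ξ t))) - Minkowski.bilin) (A' v) (A t w) +
        (Kerr.bilin M a (A t (E4.spaceEmbed (z - ξ t))) - Minkowski.bilin) (A t v) (A' w)) t := by
  set K : E4 → E4 →L[ℝ] E4 →L[ℝ] ℝ := fun y ↦ Kerr.bilin M a y - Minkowski.bilin with hKdef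
  set q : ℝ → E4 := fun s ↦ E4.spaceEmbed (z - ξ s) with hqdef
  have hq : HasDerivAt q (E4.spaceEmbed (-ξ')) t := by
    have h1 : HasDerivAt (fun s ↦ z - ξ s) (-ξ') t := hξ.const_sub z
    exact E4.spaceEmbed.hasFDerivAt.comp_hasDerivAt t h1
  have hp : HasDerivAt (fun s ↦ A s (q s)) (A' (q t) + A t (E4.spaceEmbed (-ξ'))) t :=
    hA.clm_apply hq
  have hKc : HasDerivAt (K ∘ fun s ↦ A s (q s))
      (fderiv ℝ K (A t (q t)) (A' (q t) + A t (E4.spaceEmbed (-ξ')))) t :=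
    HasFDerivAt.comp_hasDerivAt_of_eq (l := K) (f := fun s ↦ A s (q s)) t hK.hasFDerivAt hp rfl
  have hv : HasDerivAt (fun s ↦ A s v) (A' v) t := by
    simpa using hA.clm_apply (hasDerivAt_const t v)
  have hw : HasDerivAt (fun s ↦ A s w) (A' w) t := by
    simpa using hA.clm_apply (hasDerivAt_const t w)
  have hKv := hKc.clm_apply hv
  have hKvw := hKv.clm_apply hw
  simp only [Function.comp_apply, add_apply] at hKvw
  convert hKvw using 1

/-! ### Differentiability of the summand and identification of `∂₀S(x)` -/

/-- The centre path `s ↦ (s, ξ(s))` of the crux is `Cⁿ` along a `Cⁿ` `ξ`. [folklore] -/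
theorem contDiff_centre {ξ : ℝ → E3} {n : WithTop ℕ∞} (hξ : ContDiff ℝ n ξ) :
    ContDiff ℝ n (fun s ↦ E4.ofTimeSpace s (ξ s)) := by
  have hsplit : (fun s ↦ E4.ofTimeSpace s (ξ s)) =
      fun s : ℝ ↦ s • E4.basisVector 0 + E4.spaceEmbed (ξ s) :=
    funext fun s ↦ E4.ofTimeSpace_eq_smul_add' s (ξ s)
  rw [hsplit]
  exact (contDiff_id.smul contDiff_const).add (E4.spaceEmbed.contDiff.comp hξ)

/-- On the slab through the centre, the rest-frame position `Λ(t)⁻¹(0, x̲ − ξ(t))` of a point at lab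
distance `d ≥ max 1 (2|a|)` has spatial radius `≥ d > |a|` (boosts stretch spatial vectors), so the
Kerr–Schild form is smooth there. [folklore] -/
theorem le_spatialNorm_restPosition (Λ : lorentzGroup) (z : E3) :
    ‖z‖ ≤ E4.spatialNorm ((((Λ : E4 ≃L[ℝ] E4).symm : E4 →L[ℝ] E4)) (E4.spaceEmbed z)) := by
  have h0 : (E4.spaceEmbed z) 0 = 0 := by simp
  have h := norm_le_spatialNorm_lorentz_apply Λ⁻¹ h0
  rw [coe_lorentz_inv] at h
  have hn : ‖E4.spaceEmbed z‖ = ‖z‖ := by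
    rw [norm_eq_spatialNorm_of_apply_zero_eq_zero h0, E4.spaceEmbed_apply, E4.spatialNorm_ofTimeSpace]
  rw [hn] at h
  exact h

-- operator-norm instance paths on form-valued maps are slow to unify
set_option synthInstance.maxHeartbeats 200000 in
/-- **The painted summand is `C¹` at every slab point far from its centre**: if the motion
`s ↦ Λ(s)` (as operators) and the centre `ξ` are `C¹`, `x⁰ = t` and `‖x̲ − ξ(t)‖ ≥ max 1 (2|a|)`,
then `S` is `C¹` at `x` (composition of the Kerr–Schild perturbation, smooth off the ring, with the
smooth rest-frame position, framed by the smooth `Λ(y⁰)⁻¹`). [cite: KerrSchild1965, §3] -/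
theorem contDiffAt_summand {M a : ℝ} {Λ : ℝ → lorentzGroup} {ξ : ℝ → E3}
    (hΛ : ContDiff ℝ 1 (fun s ↦ ((Λ s : E4 ≃L[ℝ] E4) : E4 →L[ℝ] E4))) (hξ : ContDiff ℝ 1 ξ)
    {x : E4} {t : ℝ} (hx : x 0 = t) (hd : max 1 (2 * |a|) ≤ ‖E4.spatial x - ξ t‖) :
    ContDiffAt ℝ 1 (fun y : E4 ↦ boostedKerrBilin (Λ (y 0)) (E4.ofTimeSpace (y 0) (ξ (y 0))) M a y -
      Minkowski.bilin) x := by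
  rw [boostedKerrBilin_sub_eq_bilinearComp]
  set A : ℝ → E4 →L[ℝ] E4 := fun s ↦ (((Λ s : E4 ≃L[ℝ] E4).symm : E4 →L[ℝ] E4)) with hAdef
  have hA : ContDiff ℝ 1 A := contDiff_lorentz_symm hΛ
  have hc : ContDiff ℝ 1 (fun s ↦ E4.ofTimeSpace s (ξ s)) := contDiff_centre hξ
  have hproj : ContDiff ℝ 1 (fun y : E4 ↦ y 0) :=
    (EuclideanSpace.proj (0 : Fin 4) : E4 →L[ℝ] ℝ).contDiff
  have hAπ : ContDiff ℝ 1 (fun y : E4 ↦ A (y 0)) := hA.comp hproj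
  have hφ : ContDiff ℝ 1 (fun y : E4 ↦ A (y 0) (y - E4.ofTimeSpace (y 0) (ξ (y 0)))) :=
    hAπ.clm_apply (contDiff_id.sub (hc.comp hproj))
  -- the rest-frame position of `x` is off the ring
  have hq : x - E4.ofTimeSpace (x 0) (ξ (x 0)) = E4.spaceEmbed (E4.spatial x - ξ t) := by
    have h := (timeLine_sub_centre hx ξ t).2
    rw [sub_self, zero_smul, add_zero] at h
    rw [hx]
    exact h
  have hrad : 0 < Kerr.radius a (A (x 0) (x - E4.ofTimeSpace (x 0) (ξ (x 0)))) := by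
    refine Kerr.radius_pos_of_abs_lt ?_
    rw [hq, hx]
    exact ((abs_lt_max_one_two_mul_abs a).trans_le hd).trans_le
      (le_spatialNorm_restPosition (Λ t) _)
  have hP : ContDiffAt ℝ 1
      (fun y : E4 ↦ Kerr.bilin M a (A (y 0) (y - E4.ofTimeSpace (y 0) (ξ (y 0)))) -
        Minkowski.bilin) x :=
    (Kerr.contDiffAt_ksPert hrad).comp x hφ.contDiffAt
  have h := contDiffWithinAt_bilinearComp_self (s := Set.univ) hP.contDiffWithinAt
    hAπ.contDiffAt.contDiffWithinAt
  exact h.contDiffAt Filter.univ_mem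

-- operator-norm instance paths on form-valued maps are slow to unify
set_option synthInstance.maxHeartbeats 200000 in
/-- **`∂₀S(x)(v, w)` is the derivative of the rest-frame scalar family.** If the summand `S` is
differentiable at a slab point `x` (`x⁰ = t`) and the scalar family
`s ↦ (g − η)(Λ(s)⁻¹(0, x̲ − ξ(s)))(Λ(s)⁻¹v, Λ(s)⁻¹w)` has derivative `δ` at `t`, then
`DS(x)[e₀](v, w) = δ` (evaluation commutes with `D`; the time line through `x` has velocity `e₀`).
[folklore] -/
theorem fderiv_summand_basisVector_zero_apply {M a : ℝ} {Λ : ℝ → lorentzGroup} {ξ : ℝ → E3}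
    {x : E4} {t : ℝ} (hx : x 0 = t)
    (hS : DifferentiableAt ℝ (fun y : E4 ↦ boostedKerrBilin (Λ (y 0))
      (E4.ofTimeSpace (y 0) (ξ (y 0))) M a y - Minkowski.bilin) x) (v w : E4) {δ : ℝ}
    (hδ : HasDerivAt (fun s ↦ (Kerr.bilin M a ((((Λ s : E4 ≃L[ℝ] E4).symm : E4 →L[ℝ] E4))
          (E4.spaceEmbed (E4.spatial x - ξ s))) - Minkowski.bilin)
        ((((Λ s : E4 ≃L[ℝ] E4).symm : E4 →L[ℝ] E4)) v)
        ((((Λ s : E4 ≃L[ℝ] E4).symm : E4 →L[ℝ] E4)) w)) δ t) :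
    fderiv ℝ (fun y : E4 ↦ boostedKerrBilin (Λ (y 0)) (E4.ofTimeSpace (y 0) (ξ (y 0))) M a y -
      Minkowski.bilin) x (E4.basisVector 0) v w = δ := by
  set S : E4 → E4 →L[ℝ] E4 →L[ℝ] ℝ := fun y : E4 ↦ boostedKerrBilin (Λ (y 0))
    (E4.ofTimeSpace (y 0) (ξ (y 0))) M a y - Minkowski.bilin with hSdef
  -- evaluation at the constant vectors `v`, `w`
  have h1 := hS.hasFDerivAt.clm_apply (hasFDerivAt_const v x)
  have h2 := h1.clm_apply (hasFDerivAt_const w x)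
  -- the time line through `x`
  have hline : HasDerivAt (fun s : ℝ ↦ x + (s - t) • E4.basisVector 0) (E4.basisVector 0) t := by
    have h := (((hasDerivAt_id t).sub_const t).smul_const (E4.basisVector 0)).const_add x
    simpa using h
  have hcomp := HasFDerivAt.comp_hasDerivAt_of_eq (l := fun y ↦ S y v w)
      (f := fun s : ℝ ↦ x + (s - t) • E4.basisVector 0) t h2 hline (by simp)
  have hfun : ((fun y ↦ S y v w) ∘ fun s : ℝ ↦ x + (s - t) • E4.basisVector 0) =
      fun s ↦ (Kerr.bilin M a ((((Λ s : E4 ≃L[ℝ] E4).symm : E4 →L[ℝ] E4))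
          (E4.spaceEmbed (E4.spatial x - ξ s))) - Minkowski.bilin)
        ((((Λ s : E4 ≃L[ℝ] E4).symm : E4 →L[ℝ] E4)) v)
        ((((Λ s : E4 ≃L[ℝ] E4).symm : E4 →L[ℝ] E4)) w) := by
    funext s
    exact summand_timeLine_apply M a Λ ξ hx s v w
  rw [hfun] at hcomp
  have huniq := hcomp.unique hδ
  simpa using huniq

-- operator-norm instance paths on form-valued maps are slow to unify
set_option synthInstance.maxHeartbeats 200000 in
/-- Registered sub-goal form (stub `painted_summand_contDiffAt` of the crux item) of `contDiffAt_summand`: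
the painted summand is `C¹` at slab points far from its centre (Kerr–Schild 1965, §3). [cite: KerrSchild1965, §3] -/
theorem painted_summand_contDiffAt : open Literature.Geometry.Lorentzian Filter Topology in ∀ {M a : ℝ} {Λ : ℝ → lorentzGroup} {ξ : ℝ → E3}, ContDiff ℝ 1 (fun s ↦ ((Λ s : E4 ≃L[ℝ] E4) : E4 →L[ℝ] E4)) → ContDiff ℝ 1 ξ → ∀ {x : E4} {t : ℝ}, x 0 = t → max 1 (2 * |a|) ≤ ‖E4.spatial x - ξ t‖ → ContDiffAt ℝ 1 (fun y : E4 ↦ boostedKerrBilin (Λ (y 0)) (E4.ofTimeSpace (y 0) (ξ (y 0))) M a y - Minkowski.bilin) x :=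
  fun hΛ hξ _ _ hx hd ↦ contDiffAt_summand hΛ hξ hx hd

end Summit.FinalStateConjecture.FinalStateConjecture.Theorems.SublinearIsFree.QuasiStationarity

end
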